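import Summits.BirchSwinnertonDyer.Rank1Residual.X11a.OrdinaryLineCohomology
import HarnessLib

/-!
# Route (3e) SELMER COMPANION, XVII: the cohomology of an UNtwisted line of `E(K̄_v)` at `v ∣ p`
# — `#H¹(Γ_{ℚ_v}, C) ≤ p²` under (α) alone (class X11a = N7; cell `b2b-bsdres`, unit
# `b2b-bsdres-x11a`, gen 28)

HONEST FRAMING (run/shared/lean/b2b/bsd-rank1-residual/, verbatim in every file): the goal of the
cell is to DELETE the COMBINATION-SHAPED residual classes of the Birch–Swinnerton-Dyer formula for
ALL analytic-rank `≤ 1` elliptic curves over `ℚ` — "full BSD formula for every rank `≤ 1` curve in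
class `C`" assembled STRICTLY from published theorems — so that the rank-`≤ 1` remainder becomes
exactly the CONSTRUCTION-SHAPED classes, which are TYPED (missing-input `Prop`s), NOT attempted.
This is not "finishing BSD". CLASS-OWNERS.md: research routes; NO CLAIM BEYOND STATED CLASSES.
THEOREMS ONLY; nothing booked; no label moves. CONDITIONAL on the PUBLISHED named fact
`localEulerPoincareCharacteristic ℚ_v` (Tate's local Euler–Poincaré characteristic, Milne *ADT*
I Thm. 2.8; the tree's named fact `hEP`) where it is a hypothesis.

## What

File VI (`X11a/OrdinaryLineCohomology.lean`, gen 27) computed `#H¹(Γ_F, C) = p` (`F = ℚ_v`,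
`v ∣ p` odd) for a `Γ`-stable line `C ≤ E(F̄)` of order `p` under (α) "some `ι` acts on `C` by `2`"
AND (β) "some `σ₀` acts by `a` on `μ_p` and by `−a` on `C`" — the TWISTED line of a NON-split
multiplicative curve. For a SPLIT multiplicative curve, or for the kernel-of-reduction line of an
ANOMALOUS good ordinary partner (`a_p ≡ 1`), the line is `C ≅ μ_p` UNtwisted: (β) fails,
`Hom_Γ(C, μ_p) ≅ ℤ/p`, and the correct count is `#H¹(Γ_F, C) = p²`. This file proves the upper
bound **`#H¹(Γ_F, C) ≤ p²` under (α) alone** (`natCard_H1_le_sq_of_line`): (α) still gives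
`C^Γ = 0`; `#H²(Γ_F, C) = #Hom_Γ(C, μ_p) ≤ #Hom(C, μ_p) ≤ #μ_p = p` (`C` is cyclic: evaluation at a
generator is injective; local duality in bidegree `(2,0)`, tree
`natCard_two_eq_natCard_invariants_homRep`); and Tate's Euler characteristic gives
`#H¹ = #C^Γ · #H² · #(ℤ_v/p) ≤ p²`. Use (gen 28 census §4 (a), the next kernel target): the
comparison index at `p` of a SPLIT multiplicative `E` with an ANOMALOUS good partner `A` is
`ι_p ≤ #H¹(Γ, C_A) / #{Kummer classes of A₁} ≤ p² / p = p` (not the crude `#E(ℚ_p)[p]·p = p²`).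

References: [MilneADT2006] I Thm. 2.8, Cor. 2.3; [GreenbergLNM1716] §2 Props. 2.2, 2.4;
HOME/b2b-bsdres-x11a/REPORT-g28.md, g28/SELMER-COMPANION-CENSUS-v4.md §3–§4.
-/

set_option autoImplicit false

noncomputable section

open scoped Classical

open WeierstrassCurve Literature.NumberTheory.EllipticCurves
  Literature.NumberTheory.GaloisRepresentations Field NumberField IsDedekindDomain

namespace Summit.BirchSwinnertonDyer.Rank1Residual.X11a.OrdinaryLine

variable {v : HeightOneSpectrum (𝓞 ℚ)} {p : ℕ} [hp : Fact p.Prime]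

/-- **`#H¹(Γ_{ℚ_v}, C) ≤ p²` for a `Γ`-stable line `C ≤ E(K̄_v)` of order `p` on which some `ι`
acts by `2`** ((α); no twist hypothesis (β)): `C^Γ = 0` by (α), `#H²(Γ, C) = #Hom_Γ(C, μ_p) ≤ p`
(local duality in bidegree `(2,0)`, Milne I Cor. 2.3, tree theorem; `C` cyclic) and Tate's local
Euler–Poincaré characteristic (the named fact `hEP`, Milne I Thm. 2.8) with `#(ℤ_v/p) = p`.
`H¹` is Mathlib's `continuousCohomology 1` of the sub-representation of the local module `E(K̄_v)`
on `C`. [cite: MilneADT2006, Ch. I §2, Thm. 2.8 and Cor. 2.3] [cite: GreenbergLNM1716, §2 Props. 2.2, 2.4] -/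
theorem natCard_H1_le_sq_of_line (hEP : localEulerPoincareCharacteristic (v.adicCompletion ℚ))
    (hpv : (p : 𝓞 ℚ) ∈ v.asIdeal) (W : WeierstrassCurve ℚ)
    (C : Submodule ℤ (localPoints W (v.adicCompletion ℚ)))
    (hC : ∀ σ : absoluteGaloisGroup (v.adicCompletion ℚ),
      C ≤ C.comap ((W.localGaloisModule (v.adicCompletion ℚ)) σ))
    [Finite C] (hcard : Nat.card C = p)
    (hα : ∃ (ι : absoluteGaloisGroup (v.adicCompletion ℚ)) (T₁ : localPoints W (v.adicCompletion ℚ)),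
      T₁ ∈ C ∧ T₁ ≠ 0 ∧ ι • T₁ = (2 : ℤ) • T₁) :
    Finite (continuousCohomology 1
      (ContinuousRep.subrepresentation (W.localGaloisModule (v.adicCompletion ℚ)) C hC).toTopRep) ∧
    Nat.card (continuousCohomology 1
      (ContinuousRep.subrepresentation (W.localGaloisModule (v.adicCompletion ℚ)) C hC).toTopRep)
        ≤ p ^ 2 := by
  have hpp : p.Prime := hp.out
  -- `H²` needs `LocallyCompactSpace Γ_F` (compactness of the absolute Galois group, a theorem of
  -- the tree, as an instance inside this proof only)
  haveI := absoluteGaloisGroup_compactSpace (v.adicCompletion ℚ)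
  -- NB: no `CharZero ℚ_v` instance before the end (it would re-route `Algebra ℚ ℚ_v`).
  haveI : NeZero ((p : ℕ) : v.adicCompletion ℚ) := ⟨by
    rw [← map_natCast (algebraMap ℚ (v.adicCompletion ℚ))]
    exact (map_ne_zero _).mpr (Nat.cast_ne_zero.mpr hpp.ne_zero)⟩
  set ρC := ContinuousRep.subrepresentation (W.localGaloisModule (v.adicCompletion ℚ)) C hC with hρC
  -- cyclicity of `C`
  have hcardC' : Nat.card C.toAddSubgroup = p := hcard
  haveI : Finite C.toAddSubgroup := ‹Finite C›
  have hcyc : ∀ {T₁ : localPoints W (v.adicCompletion ℚ)}, T₁ ∈ C → T₁ ≠ 0 → ∀ {T : localPoints W (v.adicCompletion ℚ)}, T ∈ C →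
      ∃ k : ℤ, k • T₁ = T := fun {T₁} hT₁ hT₁0 {T} hT ↦
    exists_zsmul_eq_of_card_prime C.toAddSubgroup hcardC' hT₁ hT₁0 hT
  -- the action of `Γ` on `C` through `ρC`
  have hρC_apply : ∀ (σ : absoluteGaloisGroup (v.adicCompletion ℚ)) (m : C), ((ρC σ m : C) : localPoints W (v.adicCompletion ℚ)) = σ • (m : localPoints W (v.adicCompletion ℚ)) :=
    fun σ m ↦ rfl
  -- (α) on all of `C`: `ι` acts by `2`
  obtain ⟨ι, T₁, hT₁, hT₁0, hι⟩ := hα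
  have hιall : ∀ T ∈ C, ι • T = (2 : ℤ) • T := by
    intro T hT
    obtain ⟨k, rfl⟩ := hcyc hT₁ hT₁0 hT
    rw [smul_zsmul_localPoints, hι, smul_smul, smul_smul, mul_comm]
  -- `C^Γ = 0`
  have hinv : Nat.card ρC.toTopRep.ρ.invariants = 1 := by
    haveI : Subsingleton ρC.toTopRep.ρ.invariants := by
      refine ⟨fun x y ↦ ?_⟩
      suffices h : ∀ z : ρC.toTopRep.ρ.invariants, z = 0 by rw [h x, h y]
      intro z
      have hz : ∀ g, ρC.toTopRep.ρ g z.1 = z.1 := (ContRepresentation.mem_invariants _).mp z.2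
      have h1 : ι • ((z.1 : C) : localPoints W (v.adicCompletion ℚ)) = ((z.1 : C) : localPoints W (v.adicCompletion ℚ)) := by
        rw [← hρC_apply]; exact congrArg Subtype.val (hz ι)
      rw [hιall _ (z.1 : C).2] at h1
      have h0 : ((z.1 : C) : localPoints W (v.adicCompletion ℚ)) = 0 := by
        have h2 : (2 : ℤ) • ((z.1 : C) : localPoints W (v.adicCompletion ℚ)) - ((z.1 : C) : localPoints W (v.adicCompletion ℚ)) = 0 :=
          sub_eq_zero.mpr h1
        rwa [show (2 : ℤ) • ((z.1 : C) : localPoints W (v.adicCompletion ℚ)) - ((z.1 : C) : localPoints W (v.adicCompletion ℚ)) =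
          ((z.1 : C) : localPoints W (v.adicCompletion ℚ)) by rw [two_zsmul, add_sub_cancel_right]] at h2
      exact Subtype.ext (Subtype.ext h0)
    exact Nat.card_of_subsingleton (0 : ρC.toTopRep.ρ.invariants)
  -- `#H² = #Hom_Γ(C, μ_p) ≤ #Hom(C, μ_p) ≤ p` (`C` is cyclic, generated by `T₁`)
  have hM : ∀ m : C, p ^ 1 • m = 0 := fun m ↦ by
    rw [pow_one, ← hcard]; exact card_nsmul_eq_zero'
  have hcardMu : Nat.card (DiscreteGaloisModule.MuCarrier (v.adicCompletion ℚ) (p ^ 1)) = p ^ 1 :=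
    HasEnoughRootsOfUnity.natCard_rootsOfUnity (AlgebraicClosure (v.adicCompletion ℚ)) (p ^ 1)
  haveI : Finite (DiscreteGaloisModule.MuCarrier (v.adicCompletion ℚ) (p ^ 1)) :=
    Nat.finite_of_card_ne_zero (by rw [hcardMu, pow_one]; exact hpp.ne_zero)
  -- evaluation at the generator is injective on `Hom(C, μ_p)`
  have heval : Function.Injective (fun f : HomCarrier C (DiscreteGaloisModule.MuCarrier
      (v.adicCompletion ℚ) (p ^ 1)) ↦ f ⟨T₁, hT₁⟩) := by
    intro f g hfg
    apply HomCarrier.ext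
    intro m
    obtain ⟨k, hk⟩ := hcyc hT₁ hT₁0 m.2
    have hm : m = k • (⟨T₁, hT₁⟩ : C) := Subtype.ext (by rw [← hk]; rfl)
    change f m = g m
    rw [hm, map_zsmul, map_zsmul]
    exact congrArg (k • ·) hfg
  haveI : Finite (HomCarrier C (DiscreteGaloisModule.MuCarrier (v.adicCompletion ℚ) (p ^ 1))) :=
    Finite.of_injective _ heval
  have hhom : Nat.card (ρC.homRep (DiscreteGaloisModule.mu (v.adicCompletion ℚ) (p ^ 1))).toTopRep.ρ.invariants ≤ p := by
    calc Nat.card (ρC.homRep (DiscreteGaloisModule.mu (v.adicCompletion ℚ) (p ^ 1))).toTopRep.ρ.invariants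
        ≤ Nat.card (HomCarrier C (DiscreteGaloisModule.MuCarrier (v.adicCompletion ℚ) (p ^ 1))) :=
          Nat.card_le_card_of_injective _ Subtype.val_injective
      _ ≤ Nat.card (DiscreteGaloisModule.MuCarrier (v.adicCompletion ℚ) (p ^ 1)) :=
          Nat.card_le_card_of_injective _ heval
      _ = p := by rw [hcardMu, pow_one]
  -- local duality in bidegree `(2,0)` and Tate's local Euler–Poincaré characteristic
  haveI : CharZero (v.adicCompletion ℚ) := charZero_adicCompletion v
  obtain ⟨-, h2⟩ := natCard_two_eq_natCard_invariants_homRep (v.adicCompletion ℚ) ρC hM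
  obtain ⟨hfin1, -, hEq⟩ := localEulerPoincareCharacteristic_adicCompletion ℚ v hEP ρC
  change Finite (continuousCohomology 1 ρC.toTopRep) at hfin1
  change _ * Nat.card (continuousCohomology 2 ρC.toTopRep) * _ =
    Nat.card (continuousCohomology 1 ρC.toTopRep) at hEq
  rw [hinv, h2, hcard, natCard_quot_adicCompletionIntegers_rat hpv, one_mul] at hEq
  refine ⟨hfin1, ?_⟩
  rw [← hEq, sq]
  exact Nat.mul_le_mul_right p hhom


end Summit.BirchSwinnertonDyer.Rank1Residual.X11a.OrdinaryLine

end
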